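import Summits.Ventures.PercRepro.ProfilePointedParallel
import Summits.Ventures.PercRepro.ProfilePointedColoop

/-!
# PercRepro — THE POINTED CONJECTURE (Ĉ) SPLITS INTO ITS TWO HALVES; THEOREM A THROUGH AN INDEPENDENT SET
(p10, gen 14; `proofs/P10-AVFULL.md` §22)

For a finite matroid `M` on `N = #E` elements and a point `p ∈ E`, split the bi-independent `k`-sets by whether
they contain `p`: `in_k := #{X ∈ BI_k : p ∈ X}` (`inCount`), `out_k := #{X ∈ BI_k : p ∉ X}` (`outCount`), so
`P_k = in_k + out_k` (`inCount_add_outCount`); `c^p_k = extCount M k p` as in ProfilePointedAverage.  THE POINTED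
CONJECTURE (Ĉ) `(N − k − 1)·P_k ≤ k·P_{k+1} + (N − 2k − 1)·c^p_k` (`PointedRow`, NOT asserted) is the SUM of the
two statements (each NOT asserted; each 0 violations on every matroid with ≤ 9 elements — 12,483 instances at
`n = 9` — and on 45,000 random binary / graphic / hub-graph matroids on 10 … 14 elements; `mining/p10/g14/`):

  (A2)  `(N − k − 1)·in_k  ≤ k·in_{k+1}`                              (`PointedRowIn`)
  (A1)  `(N − k − 1)·out_k ≤ k·out_{k+1} + (N − 2k − 1)·c^p_k`        (`PointedRowOut`)

for `2k + 2 ≤ N`.  (A2) is «Theorem A for the bi-independent sets THROUGH `p`, with both constants lowered by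
one»: it says `in_k / C(N−2, k−1)` is increasing up to the middle, i.e. the sets through `p` behave like the
bi-independent sets of a matroid on `N − 2` elements — which they are when `p` lies in a parallel pair `{p, e}`
(`in_k = P_{k−1}((M ∖ e) / p)`, (A2) = Theorem A for that minor, TIGHT on uniform minors).  (A1) interpolates
linearly in `c^p_k` between the parallel bound (`c = 0`: `out_{k+1} ≥ (N−k−1)/k · out_k`) and the coloop bound
(`c = out`: `out_{k+1} ≥ out_k`).  Its natural generalisation to an independent set `S` of any size `d` is

  (Q)   `(N − d − k)·thru_k(S) ≤ (k + 1 − d)·thru_{k+1}(S)`,  `thru_k(S) := #{X ∈ BI_k : S ⊆ X}`   (`ThruRow`),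

which at `S = ∅` is the unimodal form of Theorem A (the named fact) and at `S = {p}` is (A2); 0 violations for
`d ≤ 3` on every matroid with ≤ 8 elements and on every 9-element matroid (`d ≤ 3`, 69,805 instances at `d = 3`).

THIS FILE (everything unconditional except the four instance theorems, which invoke the named fact):
* `inCount`, `outCount`, `thruCount` and the identities `inCount_add_outCount`, `thruCount_singleton`,
  `thruCount_empty`, `inCount_zero`;
* the DEFS `PointedRowIn` (A2), `PointedRowOut` (A1), `ThruRow` (Q) — NOT asserted;
* `pointedRow_of_split : PointedRowIn α → PointedRowOut α → PointedRow α` (arithmetic), `pointedRowIn_of_thruRow`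
  (S = {p}) and `biIndepDensity_mono_of_thruRow` (S = ∅);
* THE FOUR EXTREME INSTANCES, modulo the named fact: (A2) and (A1) at every coloop (`pointedRowIn_coloop_of_fact`:
  Theorem A for `M ∖ p` at level `k − 1`; `pointedRowOut_coloop_of_fact`: `P_k(M ∖ p) ≤ P_{k+1}(M ∖ p)`) and at
  every parallel pair (`pointedRowIn_parallel_of_fact`: Theorem A at level `k − 1` for `(M ∖ e) / p`;
  `pointedRowOut_parallel_of_fact`: the same for `(M ∖ p) / e`).
Nothing here asserts (A1), (A2), (Q) or (Ĉ).
-/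

open scoped Matroid

namespace PercRepro.Cogirth

open Finset ThmH Skew

variable {α : Type} [DecidableEq α] {M : Matroid α} [M.Finite]

/-- `in_k`: the bi-independent `k`-sets containing the point `p`. -/
noncomputable def inCount (M : Matroid α) [M.Finite] (k : ℕ) (p : α) : ℕ :=
  ((biIndepSets M k).filter (fun X => p ∈ X)).card

/-- `out_k`: the bi-independent `k`-sets avoiding the point `p`. -/
noncomputable def outCount (M : Matroid α) [M.Finite] (k : ℕ) (p : α) : ℕ :=
  ((biIndepSets M k).filter (fun X => p ∉ X)).card

/-- `thru_k(S)`: the bi-independent `k`-sets containing the set `S`. -/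
noncomputable def thruCount (M : Matroid α) [M.Finite] (k : ℕ) (S : Finset α) : ℕ :=
  ((biIndepSets M k).filter (fun X => S ⊆ X)).card

/-- `P_k = in_k + out_k`. -/
theorem inCount_add_outCount (M : Matroid α) [M.Finite] (k : ℕ) (p : α) :
    inCount M k p + outCount M k p = (biIndepSets M k).card := by
  unfold inCount outCount
  exact card_filter_add_card_filter_not _

/-- `thru_k({p}) = in_k`. -/
theorem thruCount_singleton (M : Matroid α) [M.Finite] (k : ℕ) (p : α) :
    thruCount M k {p} = inCount M k p := by
  unfold thruCount inCount
  simp only [singleton_subset_iff]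

/-- `thru_k(∅) = P_k`. -/
theorem thruCount_empty (M : Matroid α) [M.Finite] (k : ℕ) :
    thruCount M k ∅ = (biIndepSets M k).card := by
  unfold thruCount
  rw [filter_true_of_mem (fun X _ => empty_subset X)]

/-- No bi-independent `0`-set contains `p`. -/
theorem inCount_zero (M : Matroid α) [M.Finite] (p : α) : inCount M 0 p = 0 := by
  unfold inCount
  rw [card_eq_zero, filter_eq_empty_iff]
  intro X hX hp
  rw [mem_biIndepSets] at hX
  rw [card_eq_zero.1 hX.2.1] at hp
  exact notMem_empty p hp

/-- A loop lies in no bi-independent set. -/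
theorem inCount_eq_zero_of_rk_ne_one (p : α) (k : ℕ) (h1 : rk M {p} ≠ 1) : inCount M k p = 0 := by
  unfold inCount
  rw [card_eq_zero, filter_eq_empty_iff]
  intro X hX hpX
  rw [mem_biIndepSets] at hX
  exact h1 (by rw [rk_eq_card_of_subset_of_rk_eq_card (singleton_subset_iff.2 hpX) hX.2.2.1, card_singleton])

/-- **(A2), THE `p`-CONTAINING HALF OF (Ĉ) (NOT asserted)**: for every finite matroid on `α`, every point `p` and
every level `k` with `2k + 2 ≤ #E`, `(N − k − 1) · in_k ≤ k · in_{k+1}`. -/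
def PointedRowIn (α : Type) [DecidableEq α] : Prop :=
  ∀ (M : Matroid α) [M.Finite] (p : α) (k : ℕ), p ∈ gr M → 2 * k + 2 ≤ (gr M).card →
    ((gr M).card - k - 1) * inCount M k p ≤ k * inCount M (k + 1) p

/-- **(A1), THE `p`-AVOIDING HALF OF (Ĉ) (NOT asserted)**: for every finite matroid on `α`, every point `p` and
every level `k` with `2k + 2 ≤ #E`, `(N − k − 1) · out_k ≤ k · out_{k+1} + (N − 2k − 1) · c^p_k`. -/
def PointedRowOut (α : Type) [DecidableEq α] : Prop :=
  ∀ (M : Matroid α) [M.Finite] (p : α) (k : ℕ), p ∈ gr M → 2 * k + 2 ≤ (gr M).card →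
    ((gr M).card - k - 1) * outCount M k p ≤
      k * outCount M (k + 1) p + ((gr M).card - 2 * k - 1) * extCount M k p

/-- **(Q), THEOREM A THROUGH AN INDEPENDENT SET (NOT asserted)**: for every finite matroid on `α`, every
independent `S ⊆ E` with `d = #S` and every level `k` with `2k + 2 ≤ #E`,
`(N − d − k) · thru_k(S) ≤ (k + 1 − d) · thru_{k+1}(S)`; `S = ∅` is the unimodal form of Theorem A, `S = {p}` is
(A2). -/
def ThruRow (α : Type) [DecidableEq α] : Prop :=
  ∀ (M : Matroid α) [M.Finite] (S : Finset α) (k : ℕ), S ⊆ gr M → rk M S = S.card →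
    2 * k + 2 ≤ (gr M).card →
      ((gr M).card - S.card - k) * thruCount M k S ≤ (k + 1 - S.card) * thruCount M (k + 1) S

/-- **THE SPLIT**: (A2) and (A1) together give (Ĉ) — their sum is (Ĉ) since `P_k = in_k + out_k`. -/
theorem pointedRow_of_split (hin : PointedRowIn α) (hout : PointedRowOut α) : PointedRow α := by
  intro M _ p k hp hk
  have h1 := hin M p k hp hk
  have h2 := hout M p k hp hk
  have h3 : ((gr M).card - k - 1) * (inCount M k p + outCount M k p) ≤
      k * (inCount M (k + 1) p + outCount M (k + 1) p) + ((gr M).card - 2 * k - 1) * extCount M k p := by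
    rw [Nat.mul_add, Nat.mul_add, add_assoc]
    exact Nat.add_le_add h1 h2
  rwa [inCount_add_outCount, inCount_add_outCount] at h3

/-- `ThruRow` at `S = {p}` is (A2) (a loop `p` lies in no bi-independent set). -/
theorem pointedRowIn_of_thruRow (h : ThruRow α) : PointedRowIn α := by
  intro M _ p k hp hk
  by_cases h1 : rk M {p} = 1
  · have h2 := h M {p} k (singleton_subset_iff.2 hp) (by rw [h1, card_singleton]) hk
    rw [thruCount_singleton, thruCount_singleton, card_singleton, Nat.add_sub_cancel,
      Nat.sub_right_comm] at h2
    exact h2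
  · rw [inCount_eq_zero_of_rk_ne_one p k h1, inCount_eq_zero_of_rk_ne_one p (k + 1) h1]
    simp only [Nat.mul_zero, le_refl]

/-- `ThruRow` at `S = ∅` is the unimodal form of Theorem A. -/
theorem biIndepDensity_mono_of_thruRow (h : ThruRow α) (M : Matroid α) [M.Finite] (k : ℕ)
    (hk : 2 * k + 2 ≤ (gr M).card) :
    ((gr M).card - k) * (biIndepSets M k).card ≤ (k + 1) * (biIndepSets M (k + 1)).card := by
  have h0 : rk M ∅ = (∅ : Finset α).card :=
    rk_eq_card_of_indep' (by rw [coe_empty]; exact M.empty_indep)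
  have h2 := h M ∅ k (empty_subset _) h0 hk
  rw [thruCount_empty, thruCount_empty, card_empty, Nat.sub_zero, Nat.sub_zero] at h2
  exact h2

/-- **(A2) AT EVERY COLOOP** (conditional on the named fact): it is Theorem A for `M ∖ p` at level `k − 1`,
since `in_k = P_{k−1}(M ∖ p)`. -/
theorem pointedRowIn_coloop_of_fact (hfact : BiIndepDensityLogConcave α) (M : Matroid α) [M.Finite] {p : α}
    (hp : p ∈ gr M) (hpc : rk M ((gr M).erase p) + 1 = rk M (gr M)) (k : ℕ)
    (hk : 2 * k + 2 ≤ (gr M).card) :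
    ((gr M).card - k - 1) * inCount M k p ≤ k * inCount M (k + 1) p := by
  have hN : (gr (M ＼ ({p} : Set α))).card = (gr M).card - 1 := by
    rw [gr_delete', card_erase_of_mem hp]
  rcases Nat.eq_zero_or_pos k with rfl | hk1
  · rw [inCount_zero]
    simp only [Nat.mul_zero, Nat.zero_mul, le_refl]
  · unfold inCount
    rw [card_filter_biIndepSets_mem_coloop hp hpc hk1,
      card_filter_biIndepSets_mem_coloop hp hpc (by omega : 1 ≤ k + 1), show k + 1 - 1 = k by omega]
    have hA := biIndepDensity_mono_of_fact hfact (M ＼ ({p} : Set α)) (k - 1) (by rw [hN]; omega)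
    rw [hN, show k - 1 + 1 = k by omega] at hA
    calc ((gr M).card - k - 1) * (biIndepSets (M ＼ ({p} : Set α)) (k - 1)).card
        ≤ ((gr M).card - 1 - (k - 1)) * (biIndepSets (M ＼ ({p} : Set α)) (k - 1)).card :=
          Nat.mul_le_mul_right _ (by omega)
      _ ≤ k * (biIndepSets (M ＼ ({p} : Set α)) k).card := hA

/-- **(A1) AT EVERY COLOOP** (conditional on the named fact): with `out_k = c^p_k = P_k(M ∖ p)` it reads
`k · P_k(M ∖ p) ≤ k · P_{k+1}(M ∖ p)`, the plain monotonicity of the bi-independent counts of `M ∖ p` below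
the middle. -/
theorem pointedRowOut_coloop_of_fact (hfact : BiIndepDensityLogConcave α) (M : Matroid α) [M.Finite] {p : α}
    (hp : p ∈ gr M) (hpc : rk M ((gr M).erase p) + 1 = rk M (gr M)) (k : ℕ)
    (hk : 2 * k + 2 ≤ (gr M).card) :
    ((gr M).card - k - 1) * outCount M k p ≤
      k * outCount M (k + 1) p + ((gr M).card - 2 * k - 1) * extCount M k p := by
  have hN : (gr (M ＼ ({p} : Set α))).card = (gr M).card - 1 := by
    rw [gr_delete', card_erase_of_mem hp]
  unfold outCount
  rw [filter_biIndepSets_notMem_coloop hp hpc k, filter_biIndepSets_notMem_coloop hp hpc (k + 1),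
    extCount_coloop hp hpc k]
  obtain ⟨m, hm⟩ := Nat.exists_eq_add_of_le hk
  have hmono : (biIndepSets (M ＼ ({p} : Set α)) k).card ≤
      (biIndepSets (M ＼ ({p} : Set α)) (k + 1)).card := by
    rcases Nat.eq_zero_or_pos m with rfl | hm1
    · have hs := card_biIndepSets_symm (M ＼ ({p} : Set α)) (k := k) (by rw [hN]; omega)
      rw [hN, hm, show 2 * k + 2 + 0 - 1 - k = k + 1 by omega] at hs
      rw [hs]
    · have h := biIndepDensity_mono_of_fact hfact (M ＼ ({p} : Set α)) k (by rw [hN]; omega)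
      rw [hN, hm, show 2 * k + 2 + m - 1 - k = k + 1 + m by omega] at h
      apply Nat.le_of_mul_le_mul_left (c := k + 1) _ (by omega)
      calc (k + 1) * (biIndepSets (M ＼ ({p} : Set α)) k).card
          ≤ (k + 1 + m) * (biIndepSets (M ＼ ({p} : Set α)) k).card :=
            Nat.mul_le_mul_right _ (by omega)
        _ ≤ (k + 1) * (biIndepSets (M ＼ ({p} : Set α)) (k + 1)).card := h
  rw [hm, show 2 * k + 2 + m - k - 1 = k + 1 + m by omega,
    show 2 * k + 2 + m - 2 * k - 1 = m + 1 by omega]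
  generalize (biIndepSets (M ＼ ({p} : Set α)) k).card = b0 at hmono ⊢
  generalize (biIndepSets (M ＼ ({p} : Set α)) (k + 1)).card = b1 at hmono ⊢
  calc (k + 1 + m) * b0 = k * b0 + (m + 1) * b0 := by ring
    _ ≤ k * b1 + (m + 1) * b0 := Nat.add_le_add_right (Nat.mul_le_mul_left k hmono) _

/-- **(A2) AT EVERY PARALLEL PAIR** (conditional on the named fact): `in_k = P_{k−1}((M ∖ e) / p)` and (A2) is
exactly Theorem A for that minor (on `N − 2` elements) at level `k − 1` — tight when the minor is uniform. -/
theorem pointedRowIn_parallel_of_fact (hfact : BiIndepDensityLogConcave α) (M : Matroid α) [M.Finite]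
    {p e : α} (hp : p ∈ gr M) (he : e ∈ gr M) (hpe' : p ≠ e) (hp1 : rk M {p} = 1) (he1 : rk M {e} = 1)
    (hpe : rk M {p, e} = 1) (k : ℕ) (hk : 2 * k + 2 ≤ (gr M).card) :
    ((gr M).card - k - 1) * inCount M k p ≤ k * inCount M (k + 1) p := by
  have hfilt : ∀ j, inCount M j p = ((biIndepSets M j).filter (fun X => p ∈ X ∧ e ∉ X)).card := by
    intro j
    unfold inCount
    apply congrArg Finset.card
    apply filter_congr
    intro X hX
    constructor
    · intro hpX
      refine ⟨hpX, fun heX => ?_⟩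
      rw [mem_biIndepSets] at hX
      exact not_pair_subset_of_parallel' hpe' hpe hX.2.2.1
        (insert_subset hpX (singleton_subset_iff.2 heX))
    · exact fun h => h.1
  have hN : (gr ((M ＼ ({e} : Set α)) ／ ({p} : Set α))).card = (gr M).card - 1 - 1 := by
    rw [gr_contract', gr_delete', card_erase_of_mem (mem_erase.2 ⟨hpe', hp⟩), card_erase_of_mem he]
  rcases Nat.eq_zero_or_pos k with rfl | hk1
  · rw [inCount_zero]
    simp only [Nat.mul_zero, Nat.zero_mul, le_refl]
  · rw [hfilt, hfilt, card_filter_biIndepSets_parallel_half hp he hpe' hp1 he1 hpe hk1,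
      card_filter_biIndepSets_parallel_half hp he hpe' hp1 he1 hpe (by omega : 1 ≤ k + 1),
      show k + 1 - 1 = k by omega]
    have hA := biIndepDensity_mono_of_fact hfact ((M ＼ ({e} : Set α)) ／ ({p} : Set α)) (k - 1)
      (by rw [hN]; omega)
    rw [hN, show k - 1 + 1 = k by omega,
      show (gr M).card - 1 - 1 - (k - 1) = (gr M).card - k - 1 by omega] at hA
    exact hA

/-- **(A1) AT EVERY PARALLEL PAIR** (conditional on the named fact): `c^p_k = 0`, `out_k = P_{k−1}((M ∖ p) / e)`
and (A1) is exactly Theorem A for that minor at level `k − 1`. -/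
theorem pointedRowOut_parallel_of_fact (hfact : BiIndepDensityLogConcave α) (M : Matroid α) [M.Finite]
    {p e : α} (hp : p ∈ gr M) (he : e ∈ gr M) (hpe' : p ≠ e) (hp1 : rk M {p} = 1) (he1 : rk M {e} = 1)
    (hpe : rk M {p, e} = 1) (k : ℕ) (hk : 2 * k + 2 ≤ (gr M).card) :
    ((gr M).card - k - 1) * outCount M k p ≤
      k * outCount M (k + 1) p + ((gr M).card - 2 * k - 1) * extCount M k p := by
  have hep : rk M {e, p} = 1 := by rw [pair_comm]; exact hpe
  have hfilt : ∀ j, outCount M j p = ((biIndepSets M j).filter (fun X => e ∈ X ∧ p ∉ X)).card := by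
    intro j
    unfold outCount
    apply congrArg Finset.card
    apply filter_congr
    intro X hX
    constructor
    · intro hpX
      refine ⟨?_, hpX⟩
      by_contra heX
      rw [mem_biIndepSets] at hX
      exact not_pair_subset_of_parallel' hpe' hpe hX.2.2.2
        (insert_subset (mem_sdiff.2 ⟨hp, hpX⟩) (singleton_subset_iff.2 (mem_sdiff.2 ⟨he, heX⟩)))
    · exact fun h => h.2
  rw [extCount_parallel hp he hpe' hpe k, Nat.mul_zero, Nat.add_zero]
  have hN : (gr ((M ＼ ({p} : Set α)) ／ ({e} : Set α))).card = (gr M).card - 1 - 1 := by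
    rw [gr_contract', gr_delete', card_erase_of_mem (mem_erase.2 ⟨hpe'.symm, he⟩), card_erase_of_mem hp]
  rcases Nat.eq_zero_or_pos k with rfl | hk1
  · have h0 : outCount M 0 p = 0 := by
      unfold outCount
      exact le_antisymm ((card_filter_le _ _).trans
        (card_biIndepSets_zero_parallel hp he hpe' hpe).le) (Nat.zero_le _)
    rw [h0]
    simp only [Nat.mul_zero, Nat.zero_mul, le_refl]
  · rw [hfilt, hfilt, card_filter_biIndepSets_parallel_half he hp hpe'.symm he1 hp1 hep hk1,
      card_filter_biIndepSets_parallel_half he hp hpe'.symm he1 hp1 hep (by omega : 1 ≤ k + 1),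
      show k + 1 - 1 = k by omega]
    have hA := biIndepDensity_mono_of_fact hfact ((M ＼ ({p} : Set α)) ／ ({e} : Set α)) (k - 1)
      (by rw [hN]; omega)
    rw [hN, show k - 1 + 1 = k by omega,
      show (gr M).card - 1 - 1 - (k - 1) = (gr M).card - k - 1 by omega] at hA
    exact hA

end PercRepro.Cogirth
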